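import Summits.Ventures.Crystal3D.Theorems.StickyWulffConstantTextureBuildRiserHexagons
import Summits.Ventures.Crystal3D.Theorems.StickyWulffConstantTextureBuildCutFrames
import HarnessLib

/-!
# The RISER PACKAGE (B6), part 6: ENTERING a container at a generic point; half-balls; hexagon bookkeeping
# (lane T, crux `TextureLiminfV5`, stmt-Ventures-23912; design memo HOME/wulff-p2/g21/B6-DESIGN-g21.md §2 (BX); target `RiserPackage₇` of '…TextureBuildMeshV7')

HONEST FRAMING. Venture `Summits/Ventures/Crystal3D` (cell `crystal3d-full`), route `route-Ventures-StickyWulffConstant`, helper `--supports` the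
law-v5 crux `TextureLiminfV5` (stmt-Ventures-23912).  Elementary tools for the box rows of `BoxRow` (standard axioms; no mesh constructed; F-C1 not moved).

* `TexInput.halfBall` — at a generic boundary point `y` of piece `i` on the plane of its datum `p`, a small open HALF-ball `{⟪p.1,·⟫ < p.2}` lies in the piece
  ('…CellFlip' `ball_subset_flip_and_self`); `exists_mem_inner_gt` — hence, for a unit direction `n ≠ p.1`, points of the piece just above `y` in direction `n`;
* **`TexInput.enter`** — if `y` satisfies the CLOSED constraints of a container `G ⊆ 𝓗`, `antip p ∉ G`, then the piece lies in `polytope G`;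
* hexagon bookkeeping in the riser frame: the six directions as `a·u + b·v` (`sixDir_coef`), opposite directions (`sixDir_neg`), the HEXAGON STEP
  (`hexagon_step`: a point of the closed hexagon of `c` on the wall towards `c + d` lies in the closed hexagon of `c + d`), the shifted wall datum
  (`Mesh₅.hexWall_shift`), the site inside its own prism (`mem_polytope_hexPrism_self`, `antip_not_mem_hexPrism`), closed membership
  (`closed_hexPrism_of_hexagon`, `hexagon_of_mem_closure_hexPrism`) and `dist_le_one_of_hexagon`.
-/

noncomputable section

open scoped BigOperators InnerProductSpace

namespace Summit.Ventures.Crystal3D.Cruxes.TextureLiminf.TexShadow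

open Summit.Ventures.Crystal3D Summit.Ventures.Crystal3D.Theorems Set
open Summit.Ventures.Crystal3D.TentCertificate (hB hB_sq hB_pos)
open Literature.MathematicalPhysics.StatisticalMechanics (triangularVec₁ triangularVec₂)

/-! ### The six directions in the basis `u, v` -/

/-- Every in-plane direction is `a·u + b·v` with `(a, b)` one of the six unit pairs. -/
theorem sixDir_coef (t : Fin 6) : ∃ a b : ℝ, sixDir t = a • (triangularVec₁ 1 : E3) + b • triangularVec₂ 1 ∧
    ((a = 1 ∧ b = 0) ∨ (a = 0 ∧ b = 1) ∨ (a = -1 ∧ b = 1) ∨ (a = -1 ∧ b = 0) ∨ (a = 0 ∧ b = -1) ∨ (a = 1 ∧ b = -1)) := by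
  fin_cases t
  · refine ⟨1, 0, ?_, Or.inl ⟨rfl, rfl⟩⟩
    show (triangularVec₁ 1 : E3) = _; rw [one_smul, zero_smul, add_zero]
  · refine ⟨0, 1, ?_, Or.inr (Or.inl ⟨rfl, rfl⟩)⟩
    show (triangularVec₂ 1 : E3) = _; rw [one_smul, zero_smul, zero_add]
  · refine ⟨-1, 1, ?_, Or.inr (Or.inr (Or.inl ⟨rfl, rfl⟩))⟩
    show (triangularVec₂ 1 - triangularVec₁ 1 : E3) = _; rw [one_smul, neg_one_smul]; abel
  · refine ⟨-1, 0, ?_, Or.inr (Or.inr (Or.inr (Or.inl ⟨rfl, rfl⟩)))⟩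
    show (-triangularVec₁ 1 : E3) = _; rw [zero_smul, neg_one_smul, add_zero]
  · refine ⟨0, -1, ?_, Or.inr (Or.inr (Or.inr (Or.inr (Or.inl ⟨rfl, rfl⟩))))⟩
    show (-triangularVec₂ 1 : E3) = _; rw [zero_smul, neg_one_smul, zero_add]
  · refine ⟨1, -1, ?_, Or.inr (Or.inr (Or.inr (Or.inr (Or.inr ⟨rfl, rfl⟩))))⟩
    show (triangularVec₁ 1 - triangularVec₂ 1 : E3) = _; rw [one_smul, neg_one_smul]; abel

/-- Every direction has its opposite among the six. -/
theorem sixDir_neg (t : Fin 6) : ∃ t', sixDir t' = -sixDir t := by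
  fin_cases t
  · exact ⟨3, rfl⟩
  · exact ⟨4, rfl⟩
  · refine ⟨5, ?_⟩; show (triangularVec₁ 1 - triangularVec₂ 1 : E3) = -(triangularVec₂ 1 - triangularVec₁ 1); rw [neg_sub]
  · refine ⟨0, ?_⟩; show (triangularVec₁ 1 : E3) = - -triangularVec₁ 1; rw [neg_neg]
  · refine ⟨1, ?_⟩; show (triangularVec₂ 1 : E3) = - -triangularVec₂ 1; rw [neg_neg]
  · refine ⟨2, ?_⟩; show (triangularVec₂ 1 - triangularVec₁ 1 : E3) = -(triangularVec₁ 1 - triangularVec₂ 1); rw [neg_sub]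

/-- `⟪u, u⟫ = 1`. -/
private theorem inner_u_u : ⟪(triangularVec₁ 1 : E3), triangularVec₁ 1⟫_ℝ = 1 := by
  rw [EuclideanSpace.inner_eq_star_dotProduct]
  simp [dotProduct, Fin.sum_univ_three, triangularVec₁]

/-- `⟪v, v⟫ = 1`. -/
private theorem inner_v_v : ⟪(triangularVec₂ 1 : E3), triangularVec₂ 1⟫_ℝ = 1 := by
  rw [EuclideanSpace.inner_eq_star_dotProduct]
  have h3 : Real.sqrt 3 * Real.sqrt 3 = 3 := Real.mul_self_sqrt (by norm_num)
  simp [dotProduct, Fin.sum_univ_three, triangularVec₂]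
  nlinarith [h3]

/-- `⟪u, v⟫ = 1/2`. -/
private theorem inner_u_v : ⟪(triangularVec₁ 1 : E3), triangularVec₂ 1⟫_ℝ = 1 / 2 := by
  rw [EuclideanSpace.inner_eq_star_dotProduct]
  simp [dotProduct, Fin.sum_univ_three, triangularVec₁, triangularVec₂]

/-- `⟪v, u⟫ = 1/2`. -/
private theorem inner_v_u : ⟪(triangularVec₂ 1 : E3), triangularVec₁ 1⟫_ℝ = 1 / 2 := by
  rw [real_inner_comm]; exact inner_u_v

/-- The six hexagon constraints in the basis: `p, q, q − p, −p, −q, p − q ≤ κ`. -/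
theorem six_le_iff (L : E3 ≃ₗᵢ[ℝ] E3) (w : E3) (κ : ℝ) :
    (∀ t, ⟪L (sixDir t), w⟫_ℝ ≤ κ) ↔
      (⟪L (triangularVec₁ 1), w⟫_ℝ ≤ κ ∧ ⟪L (triangularVec₂ 1), w⟫_ℝ ≤ κ ∧ ⟪L (triangularVec₂ 1), w⟫_ℝ - ⟪L (triangularVec₁ 1), w⟫_ℝ ≤ κ ∧
        -⟪L (triangularVec₁ 1), w⟫_ℝ ≤ κ ∧ -⟪L (triangularVec₂ 1), w⟫_ℝ ≤ κ ∧ ⟪L (triangularVec₁ 1), w⟫_ℝ - ⟪L (triangularVec₂ 1), w⟫_ℝ ≤ κ) := by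
  constructor
  · intro h
    refine ⟨?_, ?_, ?_, ?_, ?_, ?_⟩
    · have := h 0; rwa [sixDir_zero] at this
    · have := h 1; rwa [sixDir_one] at this
    · have := h 2; rwa [sixDir_two, map_sub, inner_sub_left] at this
    · have := h 3; rwa [sixDir_three, map_neg, inner_neg_left] at this
    · have := h 4; rwa [sixDir_four, map_neg, inner_neg_left] at this
    · have := h 5; rwa [sixDir_five, map_sub, inner_sub_left] at this
  · rintro ⟨h0, h1, h2, h3, h4, h5⟩ t
    obtain ⟨a, b, ht, hab⟩ := sixDir_coef t
    rw [ht, map_add, LinearIsometryEquiv.map_smul, LinearIsometryEquiv.map_smul, inner_add_left, real_inner_smul_left, real_inner_smul_left]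
    rcases hab with ⟨rfl, rfl⟩ | ⟨rfl, rfl⟩ | ⟨rfl, rfl⟩ | ⟨rfl, rfl⟩ | ⟨rfl, rfl⟩ | ⟨rfl, rfl⟩ <;> linarith

/-- **HEXAGON STEP**: a point of the closed hexagon of the origin lying ON the wall in direction `d = sixDir t` belongs to the closed hexagon of `d`. -/
theorem hexagon_step (L : E3 ≃ₗᵢ[ℝ] E3) (w : E3) (h : ∀ s, ⟪L (sixDir s), w⟫_ℝ ≤ 1 / 2) {t : Fin 6} (ht : ⟪L (sixDir t), w⟫_ℝ = 1 / 2) :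
    ∀ s, ⟪L (sixDir s), w - L (sixDir t)⟫_ℝ ≤ 1 / 2 := by
  obtain ⟨h0, h1, h2, h3, h4, h5⟩ := (six_le_iff L w _).1 h
  intro s
  obtain ⟨a, b, hs, has⟩ := sixDir_coef s
  obtain ⟨a', b', ht', hat⟩ := sixDir_coef t
  rw [ht', map_add, LinearIsometryEquiv.map_smul, LinearIsometryEquiv.map_smul, inner_add_left, real_inner_smul_left, real_inner_smul_left] at ht
  rw [inner_sub_right, LinearIsometryEquiv.inner_map_map, hs, ht']
  simp only [map_add, LinearIsometryEquiv.map_smul, inner_add_left, inner_add_right, real_inner_smul_left, real_inner_smul_right, inner_u_u, inner_v_v,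
    inner_u_v, inner_v_u]
  rcases has with ⟨rfl, rfl⟩ | ⟨rfl, rfl⟩ | ⟨rfl, rfl⟩ | ⟨rfl, rfl⟩ | ⟨rfl, rfl⟩ | ⟨rfl, rfl⟩ <;>
    rcases hat with ⟨rfl, rfl⟩ | ⟨rfl, rfl⟩ | ⟨rfl, rfl⟩ | ⟨rfl, rfl⟩ | ⟨rfl, rfl⟩ | ⟨rfl, rfl⟩ <;> linarith

/-- In the closed hexagon (`≤ 1/2` in the six directions) the in-plane part is at most `1/√3`; with a height offset at most `hB` the distance is at most `1`. -/
theorem dist_le_one_of_hexagon (L : E3 ≃ₗᵢ[ℝ] E3) {y c : E3} (h : ∀ t, ⟪L (sixDir t), y - c⟫_ℝ ≤ 1 / 2)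
    (hh : |⟪L e₃, y - c⟫_ℝ| ≤ hB) : dist y c ≤ 1 := by
  have hin := Mesh₅.inplane_sq_le_third_of_hexagon L (y - c) h
  have hsq : ⟪L e₃, y - c⟫_ℝ ^ 2 ≤ 2 / 3 := by
    rw [← hB_sq, ← sq_abs]; exact pow_le_pow_left₀ (abs_nonneg _) hh 2
  rw [dist_eq_norm]
  nlinarith [norm_nonneg (y - c)]

namespace TexInput

variable {C R₀ : ℝ} {N : ℕ} {x : Fin N → E3} {rc : RiseredCover C R₀ N x} {δ : ℝ} {μ : Mesh₅ rc δ} (I : TexInput rc μ)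

/-! ### Half-balls at generic boundary points -/

/-- **HALF-BALL**: at a generic point `y` of the closed piece on the plane of its datum `p`, a small open half-ball `{⟪p.1, ·⟫ < p.2}` lies in the piece. -/
theorem halfBall {i : Fin I.cells.M} {p : E3 × ℝ} (hp : p ∈ I.cells.Hp i) {y : E3} (hy : y ∈ closure (polytope (I.cells.Hp i)))
    (hgen : I.Generic p y) : ∃ ε : ℝ, 0 < ε ∧ Metric.ball y ε ∩ {x : E3 | ⟪p.1, x⟫_ℝ < p.2} ⊆ polytope (I.cells.Hp i) := by
  obtain ⟨ε, hε, -, hnear⟩ := ball_subset_flip_and_self (𝓗 := I.𝓗) (T := I.cells.T (I.cells.idx i)) hp hy hgen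
  exact ⟨ε, hε, hnear⟩

/-- **Points just above**: for a unit direction `n ≠ p.1` and every `η > 0` the piece has a point `w` with `⟪n, y⟫ < ⟪n, w⟫ < ⟪n, y⟫ + η`. -/
theorem exists_mem_inner_gt {i : Fin I.cells.M} {p : E3 × ℝ} (hp : p ∈ I.cells.Hp i) {y : E3} (hy : y ∈ closure (polytope (I.cells.Hp i)))
    (hgen : I.Generic p y) {n : E3} (hn : ‖n‖ = 1) (hpn : p.1 ≠ n) {η : ℝ} (hη : 0 < η) :
    ∃ w ∈ polytope (I.cells.Hp i), ⟪n, y⟫_ℝ < ⟪n, w⟫_ℝ ∧ ⟪n, w⟫_ℝ < ⟪n, y⟫_ℝ + η := by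
  obtain ⟨ε, hε, hball⟩ := I.halfBall hp hy hgen
  have hp1 : ‖p.1‖ = 1 := I.cells.hunit_Hp i p hp
  have hpy : ⟪p.1, y⟫_ℝ ≤ p.2 := inner_le_of_mem_closure_polytope _ hy p hp
  -- `⟪p.1, n⟫ < 1`
  have hlt : ⟪p.1, n⟫_ℝ < 1 := by
    have hle : ⟪p.1, n⟫_ℝ ≤ 1 := by
      have := real_inner_le_norm p.1 n; rw [hp1, hn, one_mul] at this; exact this
    rcases hle.lt_or_eq with h | h
    · exact h
    · exact absurd ((inner_eq_one_iff_of_norm_eq_one (𝕜 := ℝ) hp1 hn).1 h) hpn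
  set d : E3 := n - p.1 with hd
  have hpd : ⟪p.1, d⟫_ℝ < 0 := by
    rw [hd, inner_sub_right, real_inner_self_eq_norm_sq, hp1]; linarith
  have hnd : 0 < ⟪n, d⟫_ℝ := by
    rw [hd, inner_sub_right, real_inner_self_eq_norm_sq, hn, real_inner_comm]; linarith
  have hnd2 : ⟪n, d⟫_ℝ ≤ 2 := by
    rw [hd, inner_sub_right, real_inner_self_eq_norm_sq, hn, real_inner_comm]
    have := real_inner_le_norm p.1 n
    have := neg_le_of_abs_le (abs_real_inner_le_norm p.1 n)
    rw [hp1, hn] at *; linarith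
  have hdn : ‖d‖ ≤ 2 := by
    calc ‖d‖ ≤ ‖n‖ + ‖p.1‖ := norm_sub_le _ _
      _ = 2 := by rw [hn, hp1]; norm_num
  set t : ℝ := min (ε / 4) (η / 4) with ht
  have ht0 : 0 < t := lt_min (by linarith) (by linarith)
  have htε : t ≤ ε / 4 := min_le_left _ _
  have htη : t ≤ η / 4 := min_le_right _ _
  refine ⟨y + t • d, hball ⟨?_, ?_⟩, ?_, ?_⟩
  · rw [Metric.mem_ball, dist_eq_norm, add_sub_cancel_left, norm_smul, Real.norm_eq_abs, abs_of_pos ht0]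
    nlinarith
  · show ⟪p.1, y + t • d⟫_ℝ < p.2
    rw [inner_add_right, real_inner_smul_right]; nlinarith
  · rw [inner_add_right, real_inner_smul_right]; nlinarith
  · rw [inner_add_right, real_inner_smul_right]; nlinarith

/-! ### Entering a container -/

/-- **ENTER**: if the generic boundary point `y` of piece `i` (on the plane of its datum `p`) satisfies the CLOSED constraints of a container `G ⊆ 𝓗` and
`antip p ∉ G`, then the piece lies in `polytope G`. -/
theorem enter {i : Fin I.cells.M} {p : E3 × ℝ} (hp : p ∈ I.cells.Hp i) {y : E3} (hy : y ∈ closure (polytope (I.cells.Hp i)))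
    (hgen : I.Generic p y) {G : Finset (E3 × ℝ)} (hG : G ⊆ I.𝓗) (hyG : ∀ q ∈ G, ⟪q.1, y⟫_ℝ ≤ q.2) (hap : antip p ∉ G) :
    polytope (I.cells.Hp i) ⊆ polytope G := by
  classical
  set U : Set E3 := ⋂ q ∈ G.filter (fun q => q ≠ p), {x : E3 | ⟪q.1, x⟫_ℝ < q.2} with hU
  have hUo : IsOpen U := isOpen_biInter_finset fun _ _ => isOpen_lt (continuous_const.inner continuous_id) continuous_const
  have hyU : y ∈ U := by
    simp only [hU, mem_iInter, mem_setOf_eq, Finset.mem_filter]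
    rintro q ⟨hq, hqp⟩
    have hqa : q ≠ antip p := fun h => hap (h ▸ hq)
    exact lt_of_le_of_ne (hyG q hq) (hgen q (hG hq) (not_or.2 ⟨hqp, hqa⟩))
  obtain ⟨δ', hδ, hballU⟩ := Metric.isOpen_iff.1 hUo y hyU
  obtain ⟨w, hw, hwd⟩ := Metric.mem_closure_iff.1 hy δ' hδ
  have hwU : w ∈ U := hballU (Metric.mem_ball'.2 hwd)
  have hwG : w ∈ polytope G := by
    simp only [polytope, mem_iInter, mem_setOf_eq]
    intro q hq
    by_cases hqp : q = p
    · rw [hqp]; exact polytope_subset_halfspace hp hw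
    · simp only [hU, mem_iInter, mem_setOf_eq, Finset.mem_filter] at hwU
      exact hwU q ⟨hq, hqp⟩
  exact I.subset_of_mem_closure hG hw (subset_closure hwG)

end TexInput

namespace Mesh₅

variable {C R₀ : ℝ} {N : ℕ} {x : Fin N → E3} {rc : RiseredCover C R₀ N x} {δ : ℝ} (μ : Mesh₅ rc δ)

/-! ### Hexagon prisms: the shifted wall, the site inside, closed membership -/

/-- **The wall of `G_c` towards `c + d` is, read from the other side, a wall of `G_{c+d}`**: `hexWall (c + rL d_t) t' = antip (hexWall c t)` for the opposite `t'`. -/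
theorem hexWall_shift (r : Fin rc.nr) (c : E3) (t : Fin 6) : ∃ t', μ.hexWall r (c + μ.rL r (sixDir t)) t' = antip (μ.hexWall r c t) := by
  obtain ⟨t', ht'⟩ := sixDir_neg t
  refine ⟨t', ?_⟩
  have hself : ⟪μ.rL r (sixDir t), μ.rL r (sixDir t)⟫_ℝ = 1 := by
    rw [LinearIsometryEquiv.inner_map_map, real_inner_self_eq_norm_sq, norm_sixDir, one_pow]
  simp only [hexWall, antip, ht', map_neg, inner_neg_left, inner_add_right, hself]
  refine Prod.ext rfl ?_
  simp only
  ring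

/-- The riser height difference is the `e₃`-component in the riser frame. -/
theorem rheight_sub (r : Fin rc.nr) (y c : E3) : μ.rheight r y - μ.rheight r c = ⟪μ.rL r e₃, y - c⟫_ℝ := by
  rw [μ.rheight_eq, μ.rheight_eq, ← μ.rn_eq r, inner_sub_right]; ring

/-- **A site lies in its own prism.** -/
theorem mem_polytope_hexPrism_self {r : Fin rc.nr} {c : E3} {m : ℤ} (hc : μ.rheight r c = (m : ℝ) * hB) : c ∈ polytope (μ.hexPrism r c m) := by
  rw [μ.mem_polytope_hexPrism_iff]
  refine ⟨fun t => by linarith, ?_, ?_⟩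
  · rw [hc]; exact (μ.govLo_lt_govHi r m).1
  · rw [hc]; exact (μ.govLo_lt_govHi r m).2

/-- Hence no prism carries a datum together with its antipode. -/
theorem antip_not_mem_hexPrism {r : Fin rc.nr} {c : E3} {m : ℤ} (hc : μ.rheight r c = (m : ℝ) * hB) {q : E3 × ℝ} (hq : q ∈ μ.hexPrism r c m) :
    antip q ∉ μ.hexPrism r c m := by
  intro ha
  have h1 := polytope_subset_halfspace hq (μ.mem_polytope_hexPrism_self hc)
  have h2 := polytope_subset_halfspace ha (μ.mem_polytope_hexPrism_self hc)
  simp only [antip, mem_setOf_eq, inner_neg_left] at h1 h2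
  linarith

/-- **Closed membership**: the closed hexagon inequalities and the closed governing window give the closed constraints of the prism. -/
theorem closed_hexPrism_of_hexagon {r : Fin rc.nr} {c : E3} {m : ℤ} {y : E3} (hhex : ∀ t, ⟪μ.rL r (sixDir t), y - c⟫_ℝ ≤ 1 / 2)
    (hlo : μ.govLo r m ≤ μ.rheight r y) (hhi : μ.rheight r y ≤ μ.govHi r m) : ∀ q ∈ μ.hexPrism r c m, ⟪q.1, y⟫_ℝ ≤ q.2 := by
  intro q hq
  rw [μ.rheight_eq] at hlo hhi
  rcases μ.mem_hexPrism_iff.1 hq with ⟨t, rfl⟩ | rfl | rfl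
  · have := hhex t; rw [inner_sub_right] at this
    show ⟪μ.rL r (sixDir t), y⟫_ℝ ≤ ⟪μ.rL r (sixDir t), c⟫_ℝ + 1 / 2; linarith
  · show ⟪rc.rn r, y⟫_ℝ ≤ μ.govHi r m + ⟪rc.rn r, μ.rs r⟫_ℝ; linarith
  · show ⟪-rc.rn r, y⟫_ℝ ≤ -(μ.govLo r m + ⟪rc.rn r, μ.rs r⟫_ℝ); rw [inner_neg_left]; linarith

/-- **From the closed prism to the closed hexagon and window.** -/
theorem hexagon_of_mem_closure_hexPrism {r : Fin rc.nr} {c : E3} {m : ℤ} {y : E3} (hy : y ∈ closure (polytope (μ.hexPrism r c m))) :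
    (∀ t, ⟪μ.rL r (sixDir t), y - c⟫_ℝ ≤ 1 / 2) ∧ μ.govLo r m ≤ μ.rheight r y ∧ μ.rheight r y ≤ μ.govHi r m := by
  have h := inner_le_of_mem_closure_polytope _ hy
  refine ⟨fun t => ?_, ?_, ?_⟩
  · have := h _ (μ.mem_hexPrism_iff.2 (Or.inl ⟨t, rfl⟩))
    simp only [hexWall] at this
    rw [inner_sub_right]; linarith
  · have := h _ (μ.mem_hexPrism_iff.2 (Or.inr (Or.inr rfl)))
    simp only [inner_neg_left] at this
    rw [μ.rheight_eq]; linarith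
  · have := h _ (μ.mem_hexPrism_iff.2 (Or.inr (Or.inl rfl)))
    simp only at this
    rw [μ.rheight_eq]; linarith

/-- **Within `1` of the site**: closed hexagon of `c` and a height within `hB` of `c`'s. -/
theorem dist_le_one_of_hexagon {r : Fin rc.nr} {c y : E3} (hhex : ∀ t, ⟪μ.rL r (sixDir t), y - c⟫_ℝ ≤ 1 / 2)
    (hh : |μ.rheight r y - μ.rheight r c| ≤ hB) : dist y c ≤ 1 := by
  rw [μ.rheight_sub] at hh
  exact TexShadow.dist_le_one_of_hexagon (μ.rL r) hhex hh

/-- The window of layer `m` lies within `hB` of the layer: `|rheight y − m·hB| ≤ hB` there. -/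
theorem abs_sub_le_hB_of_window {r : Fin rc.nr} {m : ℤ} {y : E3} (hlo : μ.govLo r m ≤ μ.rheight r y) (hhi : μ.rheight r y ≤ μ.govHi r m) :
    |μ.rheight r y - (m : ℝ) * hB| ≤ hB := by
  have h1 := μ.govLo_ge r m
  have h2 := μ.govHi_le r m
  rw [abs_le]; constructor <;> nlinarith

end Mesh₅

end Summit.Ventures.Crystal3D.Cruxes.TextureLiminf.TexShadow

end
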